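/-
COR-CM (cell pub-hodgecm2 = stage 2 of the Hodge ladder), seat p1 gen 19 (prover-pub-hodgecm2-p1-g19-0, 2026-08-21),
count-neutral CLAIM RUNBOOK-SANITY (HOME/INBOX.md 2026-08-21T03:40:53Z), second module.  Sanity / non-vacuity lemmas for
the ops review runbook `HOME/REVIEW-RUNBOOK.md` (`review-runbook/9.4`, generation 2026-08-21T03:33:07Z; targets
`hc_cm_of_PerLFace`, `hc_cm_closed`): §2 definition card D17 `PicardCM.IsBallUniformisation` (ATTENTION LIST, «no sanity
evidence») and §3 hypothesis card C1 `PicardCM.BallQuotientUniformised` (binder `h₁` of `hc_cm_closed`; shown there as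
«OPEN here» although its discharge `BallQuotient.ballQuotientUniformised_holds`, `CorCM/Geometry/BallQuotientUniformisedHolds.lean`
p246465, is a tree theorem — outside the probe's evidence scope).  Theorems only, about EXISTING declarations; no definition,
no named fact, no cited record.  LEAF module for the probe's `--also-import` evidence scope; nothing in the tree imports it.
Wording of record (lead RULING AUDIT-WORDING-2): «HC_CM follows in the kernel from BallQuotientUniformised ∧ PerLFace(model
universe of record)»; nothing here changes `Interfaces.lean` / `ModelChain.lean` or the binder table.
-/
import Summits.HodgeConjecture.CorCM.Geometry.BallQuotientUniformisedHolds
import Summits.HodgeConjecture.CorCM.Geometry.NonVacuity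
import Summits.HodgeConjecture.CorCM.Model.Universe
import HarnessLib

/-!
# Runbook sanity lemmas — COR-CM cell (`pub-hodgecm2`), cards D17 `IsBallUniformisation` and C1 `BallQuotientUniformised`

* `ballQuotientUniformised_binders_inhabited` — the six hypotheses of the record `PicardCM.BallQuotientUniformised`
  (hermitian, anisotropic, signature `(2,1)` at the inclusion, definite at the other places, congruence, torsion-free) are
  JOINTLY satisfiable, by the Picard code `Model.pmsCode F ι₁ V Γ` of the model universe at the datum
  `periodThmF_binders_inhabited` (`F = ℚ(ζ₇)`, a Landherr hermitian space, a principal congruence level;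
  `CorCM/Geometry/NonVacuity.lean`): the record — hypothesis `h₁` of `hc_cm_closed` — is not a vacuous `∀`.
* `exists_isBallUniformisation_pmsCode`, `exists_isBallUniformisation` — HOLDS-instances of the predicate
  `PicardCM.IsBallUniformisation E H Γ X unif` with NO hypothesis: apply the tree theorem
  `BallQuotient.ballQuotientUniformised_holds` (p246465) to that code; so some smooth projective surface `X/ℂ` carries a
  ball uniformisation with the five clauses (continuity, openness, surjectivity, `Γ·ℂˣ`-fibres, holomorphy in algebraic
  coordinates).
* `isBallUniformisation_of_ballQuotientUniformised` — agreement: for EVERY anisotropic Picard code the record yields such an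
  `(X, unif)` (the shape in which the model universe consumes `h₁`).
No FAILS-instance is stated: a refutation `¬ IsBallUniformisation E H Γ X unif` needs a concrete scheme `X/ℂ` with a
described set of complex points, which the tree does not construct below the model layer (reason recorded for the card).
-/

noncomputable section

namespace Summit.HodgeConjecture.CorCM.Runbook

open Literature.NumberTheory.Automorphic (PicardCM.PicardCode PicardCM.IsBallUniformisation
  PicardCM.BallQuotientUniformised)
open Literature.AlgebraicGeometry.ShimuraVarieties (hermForm IsCongruenceSubgroup signatureMatrix conjRingHom)
open Literature.AlgebraicGeometry.Motives (SchemeOver ComplexPoints IsSmoothProjective)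
open NumberField
open scoped Matrix ComplexOrder

/-- **An anisotropic Picard code exists** (kernel, no hypothesis): the code `Model.pmsCode F ι₁ V Γ` of the period-theorem
binder datum of `periodThmF_binders_inhabited` (`[F:ℚ] ≥ 6 > 2`, so the code is anisotropic by
`PicardCode.isAnisotropic_ofHermitian`). [folklore] -/
theorem exists_picardCode_isAnisotropic : ∃ c : PicardCM.PicardCode, c.IsAnisotropic := by
  obtain ⟨F, -, h6, -, ι₁, -, V, ⟨Γ⟩⟩ := periodThmF_binders_inhabited
  exact ⟨Model.pmsCode F ι₁ V Γ,
    PicardCM.PicardCode.isAnisotropic_ofHermitian ι₁ V.Hm Γ.Γ V.isHermitian V.signature_ι₁ V.posDef_of_ne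
      Γ.isCongruence Γ.torsionFree (by omega)⟩

/-- **C1 non-vacuity — the six hypotheses of `PicardCM.BallQuotientUniformised` are jointly satisfiable**: there are a
CM number field `E ⊂ ℂ`, a matrix `H ∈ M₃(E)` and a subgroup `Γ ≤ GL₃(E)` with `H` hermitian and anisotropic, of signature
`(2,1)` at the inclusion and positive definite at every other complex place, and `Γ` a torsion-free congruence subgroup of
`U(H)` — literally the binder telescope of the record (hypothesis `h₁` of `hc_cm_closed`). [folklore] -/
theorem ballQuotientUniformised_binders_inhabited :
    ∃ (E : Subfield ℂ) (_ : NumberField E) (_ : IsCMField E) (H : Matrix (Fin 3) (Fin 3) E)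
      (Γ : Subgroup (GL (Fin 3) E)),
      (∀ i j, conjRingHom E (H i j) = H j i) ∧
      (∀ v : Fin 3 → E, hermForm (conjRingHom E) H v v = 0 → v = 0) ∧
      (∃ T : GL (Fin 3) ℂ,
        (T : Matrix (Fin 3) (Fin 3) ℂ)ᴴ * H.map E.subtype * (T : Matrix (Fin 3) (Fin 3) ℂ) = signatureMatrix 2) ∧
      (∀ τ : E →+* ℂ, InfinitePlace.mk τ ≠ InfinitePlace.mk E.subtype → (H.map τ).PosDef) ∧
      IsCongruenceSubgroup (conjRingHom E) H Γ ∧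
      (∀ γ ∈ Γ, IsOfFinOrder γ → γ = 1) := by
  obtain ⟨c, hc⟩ := exists_picardCode_isAnisotropic
  exact ⟨c.E, c.isNumberField, c.isCMField, c.H, c.Γ, c.conj_H_apply, hc, c.signature, c.posDef_of_ne,
    c.isCongruenceSubgroup, c.torsionFree⟩

/-- (a) agreement, the shape in which the model consumes `h₁`: for EVERY anisotropic Picard code the record
`BallQuotientUniformised` yields a smooth projective surface `X/ℂ` with a ball uniformisation satisfying the five clauses of
`IsBallUniformisation`. [folklore] -/
theorem isBallUniformisation_of_ballQuotientUniformised (h₁ : PicardCM.BallQuotientUniformised)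
    (c : PicardCM.PicardCode) (hc : c.IsAnisotropic) :
    ∃ (X : SchemeOver ℂ) (unif : (Fin 3 → ℂ) → ComplexPoints X),
      IsSmoothProjective 2 X ∧ PicardCM.IsBallUniformisation c.E c.H c.Γ X unif :=
  h₁ c.E c.H c.Γ c.conj_H_apply hc c.signature c.posDef_of_ne c.isCongruenceSubgroup c.torsionFree

/-- (b) HOLDS-instance at a model code, NO hypothesis: some Picard code of the model universe (`Model.pmsCode …`) has a
smooth projective surface `X/ℂ` with a ball uniformisation `unif` satisfying `IsBallUniformisation` — by the tree theorem
`BallQuotient.ballQuotientUniformised_holds` (Shafarevich BAG2 IX §3.2; Kollár Thm 5.22; Mumford (4.6)/(4.14)). [folklore] -/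
theorem exists_isBallUniformisation_pmsCode :
    ∃ (c : PicardCM.PicardCode) (X : SchemeOver ℂ) (unif : (Fin 3 → ℂ) → ComplexPoints X),
      IsSmoothProjective 2 X ∧ PicardCM.IsBallUniformisation c.E c.H c.Γ X unif := by
  obtain ⟨c, hc⟩ := exists_picardCode_isAnisotropic
  exact ⟨c, isBallUniformisation_of_ballQuotientUniformised BallQuotient.ballQuotientUniformised_holds c hc⟩

/-- (b) HOLDS-instance of the predicate `PicardCM.IsBallUniformisation` in its own binders, NO hypothesis: there are
`E ⊂ ℂ`, `H`, `Γ`, a scheme `X/ℂ` (smooth projective of dimension `2`) and a map `unif : ℂ³ → X(ℂ)` with the five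
uniformisation clauses. [folklore] -/
theorem exists_isBallUniformisation :
    ∃ (E : Subfield ℂ) (H : Matrix (Fin 3) (Fin 3) E) (Γ : Subgroup (GL (Fin 3) E)) (X : SchemeOver ℂ)
      (unif : (Fin 3 → ℂ) → ComplexPoints X), IsSmoothProjective 2 X ∧ PicardCM.IsBallUniformisation E H Γ X unif := by
  obtain ⟨c, X, unif, h⟩ := exists_isBallUniformisation_pmsCode
  exact ⟨c.E, c.H, c.Γ, X, unif, h⟩

end Summit.HodgeConjecture.CorCM.Runbook

end
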